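import Literature.NumberTheory.Sieve.MontgomeryVaughan1975Section8
import Literature.NumberTheory.Sieve.LuGoldbachExceptionalSetProofs
import Literature.NumberTheory.Sieve.DivisorBound
import Literature.NumberTheory.LFunctions.SiegelExceptionalZeroBound
import HarnessLib

/-!
# Montgomery–Vaughan (1975), §8: (8.3) from the major-arc formulae — the assembly, proved

H. L. Montgomery, R. C. Vaughan, *The exceptional set in Goldbach's problem*, Acta Arith. 27
(1975) 353–370 [MontgomeryVaughanActa1975], §8 "Completion of the proof of Theorem 1"
(pp. 367–368). Theorems only; everything here is PROVED:

* `majorArc_lowerBound_of_formulae` — the named fact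
  `Literature.NumberTheory.Sieve.MontgomeryVaughan1975.majorArc_formulae` ((6.17), (6.1͂7) with
  (7.1), (7.͂1)) implies `Literature.NumberTheory.Sieve.MontgomeryVaughan1975.majorArc_lowerBound`
  ((8.3): `R₁(n) > XP^{-1/3}` for even `X/2 < n ≤ X` with `≪ XP^{-1/3}` exceptions). As in the
  paper: no exceptional character ⇒ no exceptions; an exceptional `(r̃, χ̃, β̃)` ⇒ discard the `n`
  with `(n, r̃) > P^{1/2}` (`card_filter_gcd_gt_le` and the divisor bound
  `Literature.NumberTheory.Sieve.exists_card_divisors_le_mul_rpow`: at most `d(r̃)XP^{-1/2} ≤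
  C XP^{-1/3}`), and treat the rest by the three cases of `MontgomeryVaughan1975Section8.lean`
  (`exc_case_lowerBound`). The one deviation from the printed argument: the effective lower bound
  (4.1) `1 − β̃ ≥ c₂ r̃^{-1/2} log⁻² r̃` is replaced by Siegel's (ineffective, stronger)
  `1 − β̃ ≥ C(ε) r̃^{-ε}` with `ε = 1/8`, PROVED in the tree
  (`Literature.NumberTheory.LFunctions.Siegel.exists_one_sub_realZero_ge`); the conclusion (8.3)
  only asserts the existence of the constants.
* `goldbachExceptionalCount_isBigO_rpow_of_formulae` — hence Montgomery–Vaughan's Theorem 1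
  (`Literature.NumberTheory.Sieve.goldbachExceptionalCount_isBigO_rpow`, parity.S15) follows from
  `majorArc_formulae` alone (the tree's `goldbachExceptionalCount_isBigO_rpow_of_majorArc_mv`
  supplies the minor arcs (3.2), the counting (8.1)–(8.2) and the dyadic summation).
-/

noncomputable section

open Finset MeasureTheory Filter
open scoped FourierTransform ArithmeticFunction.Moebius

namespace Literature.NumberTheory.Sieve.MontgomeryVaughan1975

/-! ### The discarded `n`, and the thresholds -/

/-- **The discarded `n`** (M–V p. 367: "the number of discarded `n` is
`∑_{d∣r̃, d>P^{1/2}} ∑_{n≤X, d∣n} 1 ≪ XP^{-1/2} d(r̃)`"): the `1 ≤ n ≤ N` with `(n, r) > M` number at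
most `d(r) · N/M`. [cite: MontgomeryVaughanActa1975, §8 (8.3)] -/
theorem card_filter_gcd_gt_le {r : ℕ} (hr : r ≠ 0) (N : ℕ) {M : ℝ} (hM : 0 < M) :
    (((Icc 1 N).filter fun n => M < (Nat.gcd n r : ℝ)).card : ℝ) ≤ (r.divisors.card : ℝ) * (N / M) := by
  classical
  set D : Finset ℕ := r.divisors.filter fun d : ℕ => M < (d : ℝ) with hD
  have hsub : ((Icc 1 N).filter fun n : ℕ => M < (Nat.gcd n r : ℝ)) ⊆
      D.biUnion fun d : ℕ => (Icc 1 N).filter fun n : ℕ => d ∣ n := by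
    intro n hn
    rw [Finset.mem_filter] at hn
    rw [Finset.mem_biUnion]
    refine ⟨Nat.gcd n r, Finset.mem_filter.mpr ⟨Nat.mem_divisors.mpr ⟨Nat.gcd_dvd_right n r, hr⟩, hn.2⟩,
      Finset.mem_filter.mpr ⟨hn.1, Nat.gcd_dvd_left n r⟩⟩
  calc (((Icc 1 N).filter fun n : ℕ => M < (Nat.gcd n r : ℝ)).card : ℝ)
      ≤ ((D.biUnion fun d : ℕ => (Icc 1 N).filter fun n : ℕ => d ∣ n).card : ℝ) := by
        exact_mod_cast Finset.card_le_card hsub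
    _ ≤ ∑ d ∈ D, (((Icc 1 N).filter fun n : ℕ => d ∣ n).card : ℝ) := by
        exact_mod_cast Finset.card_biUnion_le
    _ ≤ ∑ d ∈ D, (N : ℝ) / M := by
        refine Finset.sum_le_sum fun d hd => ?_
        have hd' := Finset.mem_filter.mp hd
        have hd0 : 0 < d := Nat.pos_of_mem_divisors hd'.1
        calc (((Icc 1 N).filter fun n : ℕ => d ∣ n).card : ℝ) ≤ (N : ℝ) / d := card_filter_dvd_Icc_le N hd0
          _ ≤ (N : ℝ) / M := div_le_div_of_nonneg_left (Nat.cast_nonneg N) hM hd'.2.le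
    _ = (D.card : ℝ) * (N / M) := by rw [Finset.sum_const, nsmul_eq_mul]
    _ ≤ (r.divisors.card : ℝ) * (N / M) := by
        gcongr
        rw [hD]
        exact Finset.filter_subset _ _

/-- **The thresholds of §8**, eventually in `X` for fixed `δ > 0` (`P = X^{6δ}`): the inequalities
"`δ` sufficiently small … `X > X₀(δ)`" used on pp. 367–368. [cite: MontgomeryVaughanActa1975, §8 (8.3)] -/
theorem eventually_thresholds {δ C C₂ c₁ C_S θ₀ κ₀ : ℝ} (hδ : 0 < δ) (hδ' : δ ≤ 1 / 12)
    (hC : 0 < C) (hC₂ : 0 < C₂) (hCS : 0 < C_S) (hθ₀ : 0 < θ₀) (hκ₀ : 0 < κ₀) :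
    ∀ᶠ X : ℝ in atTop,
      4 ≤ X ∧ 2 ≤ X ^ (6 * δ) ∧ X ^ (6 * δ) ≤ X / 2 ∧ c₁ < Real.log (X ^ (6 * δ)) ∧
      C * X ^ (1 + δ) * (X ^ (6 * δ))⁻¹ ≤ C₂ * X / 24 ∧
      C * (X * (X ^ (6 * δ)) ^ (-(1 / 3 : ℝ))) ≤ C₂ * X / 48 ∧
      X * (X ^ (6 * δ)) ^ (-(1 / 3 : ℝ)) < C₂ * X / 48 ∧
      Real.sqrt 24 * (c₁ / (C_S * Real.log (X ^ (6 * δ)))) ^ 4 ≤ θ₀ ∧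
      (C + 1) * (X ^ (6 * δ)) ^ (-(1 / 3 : ℝ)) <
        κ₀ * (X ^ (6 * δ)) ^ (-(1 / 16 : ℝ)) * Real.log (X ^ (6 * δ)) := by
  -- `P → ∞`, `log P → ∞`
  have hP : Tendsto (fun X : ℝ => X ^ (6 * δ)) atTop atTop := tendsto_rpow_atTop (by linarith)
  have hlogP : Tendsto (fun X : ℝ => Real.log (X ^ (6 * δ))) atTop atTop :=
    Real.tendsto_log_atTop.comp hP
  -- (1) `4 ≤ X`, (2) `2 ≤ P`
  have e1 : ∀ᶠ X : ℝ in atTop, 4 ≤ X := eventually_ge_atTop 4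
  have e2 : ∀ᶠ X : ℝ in atTop, 2 ≤ X ^ (6 * δ) := hP.eventually_ge_atTop 2
  -- (3) `P ≤ X/2`, i.e. `2 ≤ X^{1-6δ}`
  have e3 : ∀ᶠ X : ℝ in atTop, X ^ (6 * δ) ≤ X / 2 := by
    have h := (tendsto_rpow_atTop (by linarith : 0 < 1 - 6 * δ)).eventually_ge_atTop 2
    filter_upwards [h, eventually_gt_atTop 0] with X hX hX0
    have : X ^ (6 * δ) * X ^ (1 - 6 * δ) = X := by
      rw [← Real.rpow_add hX0]; norm_num
    have hP0 : 0 < X ^ (6 * δ) := Real.rpow_pos_of_pos hX0 _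
    nlinarith
  -- (4) `c₁ < log P`
  have e4 : ∀ᶠ X : ℝ in atTop, c₁ < Real.log (X ^ (6 * δ)) := hlogP.eventually_gt_atTop c₁
  -- (5) `C X^{1+δ} P⁻¹ ≤ C₂ X/24`: `X^{1+δ}P⁻¹ = X · X^{-5δ}` and `X^{-5δ} → 0`
  have e5 : ∀ᶠ X : ℝ in atTop, C * X ^ (1 + δ) * (X ^ (6 * δ))⁻¹ ≤ C₂ * X / 24 := by
    have h : Tendsto (fun X : ℝ => X ^ (-(5 * δ))) atTop (nhds 0) :=
      tendsto_rpow_neg_atTop (by linarith)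
    have hev := h.eventually (gt_mem_nhds (show (0 : ℝ) < C₂ / (24 * C) by positivity))
    filter_upwards [hev, eventually_gt_atTop 0] with X hX hX0
    have heq : X ^ (1 + δ) * (X ^ (6 * δ))⁻¹ = X * X ^ (-(5 * δ)) := by
      rw [← Real.rpow_neg hX0.le, ← Real.rpow_add hX0, ← Real.rpow_one_add' hX0.le (by linarith)]
      ring_nf
    rw [mul_assoc, heq]
    have : C * (X * X ^ (-(5 * δ))) = X * (C * X ^ (-(5 * δ))) := by ring
    rw [this]
    have h2 : C * X ^ (-(5 * δ)) ≤ C₂ / 24 := by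
      have := (lt_div_iff₀ (by positivity : (0:ℝ) < 24 * C)).mp hX
      nlinarith
    nlinarith
  -- (6), (7) `P^{-1/3} → 0`
  have hP3 : Tendsto (fun X : ℝ => (X ^ (6 * δ)) ^ (-(1 / 3 : ℝ))) atTop (nhds 0) :=
    (tendsto_rpow_neg_atTop (by norm_num)).comp hP
  have e6 : ∀ᶠ X : ℝ in atTop, C * (X * (X ^ (6 * δ)) ^ (-(1 / 3 : ℝ))) ≤ C₂ * X / 48 := by
    have hev := hP3.eventually (gt_mem_nhds (show (0 : ℝ) < C₂ / (48 * C) by positivity))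
    filter_upwards [hev, eventually_gt_atTop 0] with X hX hX0
    have h2 : C * (X ^ (6 * δ)) ^ (-(1 / 3 : ℝ)) ≤ C₂ / 48 := by
      have := (lt_div_iff₀ (by positivity : (0:ℝ) < 48 * C)).mp hX
      nlinarith
    nlinarith
  have e7 : ∀ᶠ X : ℝ in atTop, X * (X ^ (6 * δ)) ^ (-(1 / 3 : ℝ)) < C₂ * X / 48 := by
    have hev := hP3.eventually (gt_mem_nhds (show (0 : ℝ) < C₂ / 48 by positivity))
    filter_upwards [hev, eventually_gt_atTop 0] with X hX hX0
    nlinarith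
  -- (8) `√24 (c₁/(C_S log P))⁴ ≤ θ₀`: `(c₁/(C_S log P)) → 0`
  have e8 : ∀ᶠ X : ℝ in atTop, Real.sqrt 24 * (c₁ / (C_S * Real.log (X ^ (6 * δ)))) ^ 4 ≤ θ₀ := by
    have h1 : Tendsto (fun X : ℝ => c₁ / (C_S * Real.log (X ^ (6 * δ)))) atTop (nhds 0) :=
      Tendsto.div_atTop tendsto_const_nhds (Tendsto.const_mul_atTop hCS hlogP)
    have h2 : Tendsto (fun X : ℝ => Real.sqrt 24 * (c₁ / (C_S * Real.log (X ^ (6 * δ)))) ^ 4) atTop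
        (nhds (Real.sqrt 24 * 0 ^ 4)) := (h1.pow 4).const_mul _
    rw [zero_pow (by norm_num), mul_zero] at h2
    exact h2.eventually (ge_mem_nhds hθ₀)  -- eventually ≤ θ₀
  -- (9) `(C+1) P^{-1/3} < κ₀ P^{-1/16} log P`, i.e. `(C+1) < κ₀ P^{1/3-1/16} log P`
  have e9 : ∀ᶠ X : ℝ in atTop, (C + 1) * (X ^ (6 * δ)) ^ (-(1 / 3 : ℝ)) <
      κ₀ * (X ^ (6 * δ)) ^ (-(1 / 16 : ℝ)) * Real.log (X ^ (6 * δ)) := by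
    have h1 : Tendsto (fun P : ℝ => κ₀ * P ^ (1 / 3 - 1 / 16 : ℝ) * Real.log P) atTop atTop := by
      have ha : Tendsto (fun P : ℝ => κ₀ * P ^ (1 / 3 - 1 / 16 : ℝ)) atTop atTop :=
        Tendsto.const_mul_atTop hκ₀ (tendsto_rpow_atTop (by norm_num))
      exact ha.atTop_mul_atTop₀ Real.tendsto_log_atTop
    have h2 := (h1.comp hP).eventually_gt_atTop (C + 1)
    filter_upwards [h2, eventually_gt_atTop 1] with X hX hX1
    have hP0 : 0 < X ^ (6 * δ) := Real.rpow_pos_of_pos (by linarith) _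
    simp only [Function.comp] at hX
    have hp3 : 0 < (X ^ (6 * δ)) ^ (-(1 / 3 : ℝ)) := Real.rpow_pos_of_pos hP0 _
    have heq : κ₀ * (X ^ (6 * δ)) ^ (-(1 / 16 : ℝ)) * Real.log (X ^ (6 * δ)) =
        (κ₀ * (X ^ (6 * δ)) ^ (1 / 3 - 1 / 16 : ℝ) * Real.log (X ^ (6 * δ))) *
          (X ^ (6 * δ)) ^ (-(1 / 3 : ℝ)) := by
      have : (X ^ (6 * δ)) ^ (-(1 / 16 : ℝ)) =
          (X ^ (6 * δ)) ^ (1 / 3 - 1 / 16 : ℝ) * (X ^ (6 * δ)) ^ (-(1 / 3 : ℝ)) := by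
        rw [← Real.rpow_add hP0]; norm_num
      rw [this]; ring
    rw [heq]
    exact mul_lt_mul_of_pos_right hX hp3
  filter_upwards [e1, e2, e3, e4, e5, e6, e7, e8, e9] with X h1 h2 h3 h4 h5 h6 h7 h8 h9
  exact ⟨h1, h2, h3, h4, h5, h6, h7, h8, h9⟩


/-! ### Bookkeeping with `P = X^{6δ}` -/

/-- `X^{1+δ} P⁻¹ G ≤ X P^{-1/3}` for `P = X^{6δ}` and `0 ≤ G ≤ P^{1/2}` (the bound
`X^{1+δ}P⁻¹(n, r̃) ≤ X^{1+δ}P^{-1/2} ≪ XP^{-1/3}` of M–V p. 367). [folklore] -/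
theorem error_two_le {X δ G : ℝ} (hX : 0 < X) (hG : G ≤ (X ^ (6 * δ)) ^ (1 / 2 : ℝ)) :
    X ^ (1 + δ) * (X ^ (6 * δ))⁻¹ * G ≤ X * (X ^ (6 * δ)) ^ (-(1 / 3 : ℝ)) := by
  have hP : 0 < X ^ (6 * δ) := Real.rpow_pos_of_pos hX _
  have h1 : X ^ (1 + δ) * (X ^ (6 * δ))⁻¹ * (X ^ (6 * δ)) ^ (1 / 2 : ℝ) =
      X * (X ^ (6 * δ)) ^ (-(1 / 3 : ℝ)) := by
    rw [← Real.rpow_neg_one, ← Real.rpow_mul hX.le, ← Real.rpow_mul hX.le, ← Real.rpow_mul hX.le,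
      ← Real.rpow_add hX, ← Real.rpow_add hX]
    conv_rhs => rw [← Real.rpow_one X, ← Real.rpow_mul hX.le, ← Real.rpow_add hX]
    ring_nf
  calc X ^ (1 + δ) * (X ^ (6 * δ))⁻¹ * G ≤ X ^ (1 + δ) * (X ^ (6 * δ))⁻¹ * (X ^ (6 * δ)) ^ (1 / 2 : ℝ) :=
        mul_le_mul_of_nonneg_left hG (by positivity)
    _ = _ := h1

/-- `(24/r)^{1/2} = √24 · (r^{-1/8})⁴`. [folklore] -/
theorem sqrt_div_eq {r : ℝ} (hr : 0 < r) :
    (24 / r) ^ (1 / 2 : ℝ) = Real.sqrt 24 * (r ^ (-(1 / 8 : ℝ))) ^ 4 := by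
  rw [Real.div_rpow (by norm_num) hr.le, Real.sqrt_eq_rpow, ← Real.rpow_natCast,
    ← Real.rpow_mul hr.le, div_eq_mul_inv, ← Real.rpow_neg hr.le]
  norm_num

/-- `(24 P^{1/2})^{-1/8} = 24^{-1/8} P^{-1/16}`. [folklore] -/
theorem rpow_mul_sqrt_eq {P : ℝ} (hP : 0 < P) :
    (24 * P ^ (1 / 2 : ℝ)) ^ (-(1 / 8 : ℝ)) = (24 : ℝ) ^ (-(1 / 8 : ℝ)) * P ^ (-(1 / 16 : ℝ)) := by
  rw [Real.mul_rpow (by norm_num) (Real.rpow_nonneg hP.le _), ← Real.rpow_mul hP.le]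
  norm_num


/-! ### The exceptional case, for one `n` -/

open Literature.NumberTheory.LFunctions.Siegel in
/-- **§8 with an exceptional character, for one `n`** (M–V pp. 367–368): if `(r̃, χ̃, β̃)` is
exceptional (`χ̃` primitive quadratic, `r̃ ≤ P`, `1 − c₁/log P ≤ β̃ < 1`, Siegel/(4.1):
`C_S r̃^{-1/8} ≤ 1 − β̃`), `n` is even with `X/2 < n ≤ X` and `(n, r̃) ≤ P^{1/2}`, and `R₁(n)`
satisfies (6.1͂7)+(7.͂1), then `R₁(n) > XP^{-1/3}` — provided the thresholds ("`δ` small, `X` large")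
hold. The three cases: `(n,r̃) = 1`; `(n,r̃) > 1` with a prime `p > 3`, `p ∣ r̃`, `p ∤ n`; all such
primes divide `n` ((8.4)–(8.6), (6.21)). [cite: MontgomeryVaughanActa1975, §8 (8.4)–(8.6)] -/
theorem exc_case_lowerBound {r : ℕ} [NeZero r] {χ : DirichletCharacter ℂ r} (hprim : χ.IsPrimitive)
    (hquad : χ ^ 2 = 1) {X δ β c₁ C C_S θ₀ ε : ℝ} {n : ℕ} {R : ℂ}
    (hC : 0 < C) (hc₁ : 0 < c₁) (hCS : 0 < C_S) (hε0 : 0 ≤ ε)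
    (hX4 : 4 ≤ X) (hP2 : 2 ≤ X ^ (6 * δ)) (hPX : X ^ (6 * δ) ≤ X / 2)
    (hlogP : c₁ < Real.log (X ^ (6 * δ)))
    (hT1 : C * X ^ (1 + δ) * (X ^ (6 * δ))⁻¹ ≤ twinPrimeConst * X / 24)
    (hT2 : C * (X * (X ^ (6 * δ)) ^ (-(1 / 3 : ℝ))) ≤ twinPrimeConst * X / 48)
    (hT3 : X * (X ^ (6 * δ)) ^ (-(1 / 3 : ℝ)) < twinPrimeConst * X / 48)
    (hT4 : Real.sqrt 24 * (c₁ / (C_S * Real.log (X ^ (6 * δ)))) ^ 4 ≤ θ₀)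
    (hθ₀ : θ₀ ≤ 1 / 8) (hθ₀' : C * θ₀ ≤ twinPrimeConst / 16)
    (hT6 : (C + 1) * (X ^ (6 * δ)) ^ (-(1 / 3 : ℝ)) <
      (min (1 / 2) (1 / (4 * c₁)) * twinPrimeConst / 4 * (C_S * (24 : ℝ) ^ (-(1 / 8 : ℝ)))) *
        (X ^ (6 * δ)) ^ (-(1 / 16 : ℝ)) * Real.log (X ^ (6 * δ)))
    (hε1 : C * (c₁ * ε) ≤ twinPrimeConst / 16)
    (hε2 : C * ε ≤ min (1 / 2) (1 / (4 * c₁)) * twinPrimeConst / 4)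
    (hβlo : 1 - c₁ / Real.log (X ^ (6 * δ)) ≤ β) (hβ1 : β < 1)
    (hSieg : C_S * (r : ℝ) ^ (-(1 / 8 : ℝ)) ≤ 1 - β)
    (heven : Even n) (hwin : X / 2 < n) (hnX : (n : ℝ) ≤ X)
    (hgcd : (Nat.gcd n r : ℝ) ≤ (X ^ (6 * δ)) ^ (1 / 2 : ℝ))
    (hB : ‖R - ((goldbachSingularSeries n *
        (n + excRatio χ n * excPairSum (X ^ (6 * δ)) X β n) : ℝ) : ℂ)‖ ≤
      C * ((if n.Coprime r then (r : ℝ) * n * X / ((Nat.totient r : ℝ) ^ 2 * Nat.totient n) else 0) +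
        X ^ (1 + δ) * (X ^ (6 * δ))⁻¹ * Nat.gcd n r +
        (n : ℝ) / (Nat.totient n : ℝ) * X * ((1 - β) * Real.log (X ^ (6 * δ))) * ε)) :
    X * (X ^ (6 * δ)) ^ (-(1 / 3 : ℝ)) < R.re := by
  -- notation and basic positivity
  set P : ℝ := X ^ (6 * δ) with hPdef
  set C₂ : ℝ := twinPrimeConst with hC₂def
  have hC₂ : 0 < C₂ := lt_of_lt_of_le (by norm_num) half_le_twinPrimeConst
  have hX0 : 0 < X := by linarith
  have hP0 : 0 < P := by rw [hPdef]; exact Real.rpow_pos_of_pos hX0 _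
  have hlogP0 : 0 < Real.log P := lt_trans hc₁ hlogP
  have hr : r ≠ 0 := NeZero.ne r
  have hr0 : (0 : ℝ) < r := by exact_mod_cast Nat.pos_of_ne_zero hr
  have hn0 : n ≠ 0 := by
    rintro rfl
    simp at hwin
    linarith
  have hn1 : (1 : ℝ) ≤ n := by exact_mod_cast Nat.one_le_iff_ne_zero.mpr hn0
  have hnP : P ≤ n := by linarith
  -- `t = n/φ(n) ≥ 1`, `𝔖(n) ≥ C₂ t`
  set t : ℝ := (n : ℝ) / (Nat.totient n : ℝ) with htdef
  have hφn : (0 : ℝ) < Nat.totient n := by exact_mod_cast Nat.totient_pos.mpr (Nat.pos_of_ne_zero hn0)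
  have ht : 1 ≤ t := by
    rw [htdef, le_div_iff₀ hφn, one_mul]; exact_mod_cast Nat.totient_le n
  have h𝔖 : C₂ * t ≤ goldbachSingularSeries n := twinPrimeConst_mul_div_totient_le heven hn0
  -- the exceptional zero: `0 < β`, `L = (1-β) log P ≤ c₁`
  set L : ℝ := (1 - β) * Real.log P with hLdef
  have hL0 : 0 ≤ L := mul_nonneg (by linarith) hlogP0.le
  have hLc : L ≤ c₁ := by
    have h1 : 1 - β ≤ c₁ / Real.log P := by linarith
    calc L = (1 - β) * Real.log P := rfl
      _ ≤ c₁ / Real.log P * Real.log P := mul_le_mul_of_nonneg_right h1 hlogP0.le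
      _ = c₁ := div_mul_cancel₀ c₁ hlogP0.ne'
  have hβ0 : 0 < β := by
    have : c₁ / Real.log P < 1 := (div_lt_one hlogP0).mpr hlogP
    linarith
  -- `Ĩ`
  set I : ℝ := excPairSum P X β n with hIdef
  have hI0 : 0 ≤ I := excPairSum_nonneg _ _ _ _
  have hIX : I ≤ X := excPairSum_le hX0.le hβ1.le n
  have hIβ : I ≤ (n : ℝ) ^ β := excPairSum_le_rpow hP2 hβ0 hβ1.le n
  -- `ρ` and (8.5)
  set ρ : ℝ := excRatio χ n with hρdef
  have h85 : |ρ| ≤ ∏ p ∈ r.primeFactors.filter (fun p => ¬ p ∣ n ∧ 3 < p), ((p : ℝ) - 2)⁻¹ :=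
    abs_excRatio_le hprim hquad heven hn0
  -- the major-arc formula, real part
  have hre := re_ge_of_norm_sub_le hB
  -- the common error bound `E₂ ≤ X P^{-1/3}` and `L ε`-smallness
  have hE₂ : C * (X ^ (1 + δ) * P⁻¹ * (Nat.gcd n r : ℝ)) ≤ C₂ * X / 48 := by
    calc C * (X ^ (1 + δ) * P⁻¹ * (Nat.gcd n r : ℝ)) ≤ C * (X * P ^ (-(1 / 3 : ℝ))) :=
          mul_le_mul_of_nonneg_left (error_two_le hX0 hgcd) hC.le
      _ ≤ C₂ * X / 48 := hT2
  have hLε : C * (L * ε) ≤ C₂ / 16 := by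
    calc C * (L * ε) ≤ C * (c₁ * ε) :=
          mul_le_mul_of_nonneg_left (mul_le_mul_of_nonneg_right hLc hε0) hC.le
      _ ≤ C₂ / 16 := hε1
  -- three cases
  by_cases hcop : n.Coprime r
  · -- Case (n, r̃) = 1: `r̃` is odd, `|ρ| ≤ π(r̃) ≤ (24/r̃)^{1/2} ≤ θ₀`, `r̃/φ(r̃)² ≤ π(r̃)`
    have hodd : Odd r := by
      refine Nat.not_even_iff_odd.mp fun ⟨k, hk⟩ => ?_
      have h2r : 2 ∣ r := ⟨k, by omega⟩
      have h2n : 2 ∣ n := even_iff_two_dvd.mp heven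
      have h21 : 2 ∣ Nat.gcd n r := Nat.dvd_gcd h2n h2r
      rw [hcop] at h21
      omega
    have hfilt : r.primeFactors.filter (fun p => ¬ p ∣ n ∧ 3 < p) = r.primeFactors.filter (3 < ·) := by
      refine Finset.filter_congr fun p hp => ⟨fun h => h.2, fun h => ⟨fun hpn => ?_, h⟩⟩
      have hpr := Nat.dvd_of_mem_primeFactors hp
      have : p ∣ Nat.gcd n r := Nat.dvd_gcd hpn hpr
      rw [hcop] at this
      exact (Nat.prime_of_mem_primeFactors hp).one_lt.ne' (Nat.dvd_one.mp this)
    set θ : ℝ := (24 / (r : ℝ)) ^ (1 / 2 : ℝ) with hθdef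
    have hπθ : ∏ p ∈ r.primeFactors.filter (3 < ·), ((p : ℝ) - 2)⁻¹ ≤ θ :=
      prod_inv_sub_two_le_rpow hprim hquad
    have hρθ : |ρ| ≤ θ := by rw [hfilt] at h85; exact h85.trans hπθ
    -- `θ ≤ θ₀` from Siegel
    have hθθ₀ : θ ≤ θ₀ := by
      have hu : (r : ℝ) ^ (-(1 / 8 : ℝ)) ≤ c₁ / (C_S * Real.log P) := by
        rw [le_div_iff₀ (mul_pos hCS hlogP0)]
        calc (r : ℝ) ^ (-(1 / 8 : ℝ)) * (C_S * Real.log P) = (C_S * (r : ℝ) ^ (-(1 / 8 : ℝ))) * Real.log P := by ring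
          _ ≤ (1 - β) * Real.log P := mul_le_mul_of_nonneg_right hSieg hlogP0.le
          _ ≤ c₁ := hLc
      have hu0 : 0 ≤ (r : ℝ) ^ (-(1 / 8 : ℝ)) := Real.rpow_nonneg hr0.le _
      calc θ = Real.sqrt 24 * ((r : ℝ) ^ (-(1 / 8 : ℝ))) ^ 4 := sqrt_div_eq hr0
        _ ≤ Real.sqrt 24 * (c₁ / (C_S * Real.log P)) ^ 4 := by gcongr
        _ ≤ θ₀ := hT4
    have hE₁ : (if n.Coprime r then (r : ℝ) * n * X / ((Nat.totient r : ℝ) ^ 2 * Nat.totient n) else 0) ≤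
        θ * t * X := by
      rw [if_pos hcop]
      have hφr : (0 : ℝ) < Nat.totient r := by exact_mod_cast Nat.totient_pos.mpr (Nat.pos_of_ne_zero hr)
      have hrat : (r : ℝ) / (Nat.totient r : ℝ) ^ 2 ≤ θ :=
        (cast_div_totient_sq_le hprim hquad hodd).trans hπθ
      calc (r : ℝ) * n * X / ((Nat.totient r : ℝ) ^ 2 * Nat.totient n)
          = (r : ℝ) / (Nat.totient r : ℝ) ^ 2 * t * X := by rw [htdef]; field_simp
        _ ≤ θ * t * X := by gcongr
    have hgcd1 : (Nat.gcd n r : ℝ) = 1 := by rw [hcop]; simp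
    have hC₂X : 0 ≤ C₂ * X := by positivity
    have hE₂' : C * (X ^ (1 + δ) * P⁻¹ * (Nat.gcd n r : ℝ)) ≤ C₂ * X / 16 := by
      rw [hgcd1, mul_one, ← mul_assoc]; linarith
    have key := case_coprime hC₂ hC.le hX0 ht h𝔖 hwin hρθ hI0 hIX hE₁ (hθθ₀.trans hθ₀)
      ((mul_le_mul_of_nonneg_left hθθ₀ hC.le).trans hθ₀') hE₂' hLε
    have hfin : C₂ * X / 8 ≤ R.re := key.trans hre
    calc X * P ^ (-(1 / 3 : ℝ)) < C₂ * X / 48 := hT3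
      _ ≤ C₂ * X / 8 := by linarith
      _ ≤ R.re := hfin
  · by_cases hne : ∃ p ∈ r.primeFactors, 3 < p ∧ ¬ p ∣ n
    · -- Case (n, r̃) > 1, product non-empty: `|ρ| ≤ 1/3`
      obtain ⟨p₀, hp₀, hp₀3, hp₀n⟩ := hne
      have hρ3 : |ρ| ≤ 1 / 3 := by
        refine h85.trans ?_
        have hmem : p₀ ∈ r.primeFactors.filter (fun p => ¬ p ∣ n ∧ 3 < p) :=
          Finset.mem_filter.mpr ⟨hp₀, hp₀n, hp₀3⟩
        rw [← Finset.mul_prod_erase _ _ hmem]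
        have h1 : ((p₀ : ℝ) - 2)⁻¹ ≤ 1 / 3 := by
          have hp₀p := Nat.prime_of_mem_primeFactors hp₀
          have h5 : (5 : ℝ) ≤ p₀ := by
            exact_mod_cast hp₀p.five_le_of_ne_two_of_ne_three (by omega) (by omega)
          calc ((p₀ : ℝ) - 2)⁻¹ ≤ (3 : ℝ)⁻¹ := inv_anti₀ (by norm_num) (by linarith)
            _ = 1 / 3 := by norm_num
        have h2 : ∏ p ∈ (r.primeFactors.filter (fun p => ¬ p ∣ n ∧ 3 < p)).erase p₀, ((p : ℝ) - 2)⁻¹ ≤ 1 := by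
          refine Finset.prod_le_one (fun p hp => ?_) (fun p hp => ?_)
          · have : (4 : ℝ) ≤ p := by exact_mod_cast (Finset.mem_filter.mp (Finset.mem_of_mem_erase hp)).2.2
            exact inv_nonneg.mpr (by linarith)
          · have : (4 : ℝ) ≤ p := by exact_mod_cast (Finset.mem_filter.mp (Finset.mem_of_mem_erase hp)).2.2
            exact inv_le_one_of_one_le₀ (by linarith)
        have h0 : 0 ≤ ∏ p ∈ (r.primeFactors.filter (fun p => ¬ p ∣ n ∧ 3 < p)).erase p₀, ((p : ℝ) - 2)⁻¹ :=
          Finset.prod_nonneg fun p hp => by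
            have : (4 : ℝ) ≤ p := by exact_mod_cast (Finset.mem_filter.mp (Finset.mem_of_mem_erase hp)).2.2
            exact inv_nonneg.mpr (by linarith)
        calc ((p₀ : ℝ) - 2)⁻¹ * ∏ p ∈ (r.primeFactors.filter (fun p => ¬ p ∣ n ∧ 3 < p)).erase p₀, ((p : ℝ) - 2)⁻¹
            ≤ 1 / 3 * 1 := mul_le_mul h1 h2 h0 (by norm_num)
          _ = 1 / 3 := by norm_num
      rw [if_neg hcop] at hre
      have hC₂X : 0 ≤ C₂ * X := by positivity
      have hE₂24 : C * (X ^ (1 + δ) * P⁻¹ * (Nat.gcd n r : ℝ)) ≤ C₂ * X / 24 := hE₂.trans (by linarith)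
      have hLε12 : C * (L * ε) ≤ C₂ / 12 := hLε.trans (by linarith)
      have key := case_nonempty hC₂ hX0 ht h𝔖 hwin hρ3 hI0 hIX hE₂24 hLε12
      have hfin : C₂ * X / 24 ≤ R.re := key.trans hre
      calc X * P ^ (-(1 / 3 : ℝ)) < C₂ * X / 48 := hT3
        _ ≤ C₂ * X / 24 := by linarith
        _ ≤ R.re := hfin
    · -- Case (n, r̃) > 1, all primes `p > 3` of `r̃` divide `n`: (6.21) and (8.6)
      push Not at hne
      have hρ1 : |ρ| ≤ 1 := by
        refine h85.trans (le_of_eq ?_)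
        rw [Finset.prod_eq_one]
        intro p hp
        obtain ⟨hp, hpn, hp3⟩ := Finset.mem_filter.mp hp
        exact absurd (hne p hp hp3) hpn
      -- (6.21): `n − n^β ≥ m n`, `m ≥ c₅ L`
      set m : ℝ := min ((1 - β) * Real.log n) (1 / 2) / 2 with hmdef
      have hm1 : m ≤ 1 - (n : ℝ) ^ (-(1 - β)) := min_half_div_two_le_one_sub_rpow_neg hn1 (by linarith)
      have hnβ : (n : ℝ) ^ β ≤ n - m * n := by
        have hnpos : (0 : ℝ) < n := by linarith
        have key : (n : ℝ) ^ β = n * (n : ℝ) ^ (-(1 - β)) := by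
          have h := Real.rpow_add hnpos 1 (-(1 - β))
          rw [Real.rpow_one] at h
          rw [← h]; congr 1; ring
        rw [key]
        have := mul_le_mul_of_nonneg_left hm1 hnpos.le
        linarith
      set c₅ : ℝ := min (1 / 2) (1 / (4 * c₁)) with hc₅def
      have hc₅0 : 0 ≤ c₅ := le_min (by norm_num) (by positivity)
      have hm : c₅ * L ≤ m := by
        rcases le_or_gt ((1 - β) * Real.log n) (1 / 2) with hsm | hlg
        · -- `m = (1-β) log n / 2 ≥ (1-β) log P / 2 ≥ c₅ L`
          rw [hmdef, min_eq_left hsm]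
          have hlog : Real.log P ≤ Real.log n := Real.log_le_log hP0 hnP
          have h1 : (1 - β) * Real.log P ≤ (1 - β) * Real.log n := mul_le_mul_of_nonneg_left hlog (by linarith)
          have h2 : c₅ ≤ 1 / 2 := min_le_left _ _
          calc c₅ * L ≤ 1 / 2 * L := mul_le_mul_of_nonneg_right h2 hL0
            _ ≤ (1 - β) * Real.log n / 2 := by rw [hLdef]; linarith
        · rw [hmdef, min_eq_right hlg.le]
          have h2 : c₅ ≤ 1 / (4 * c₁) := min_le_right _ _
          calc c₅ * L ≤ 1 / (4 * c₁) * c₁ := mul_le_mul h2 hLc hL0 (by positivity)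
            _ = 1 / 2 / 2 := by field_simp; ring
      rw [if_neg hcop] at hre
      have key := case_empty (E₂ := X ^ (1 + δ) * P⁻¹ * (Nat.gcd n r : ℝ)) hC₂ hC.le hX0 ht h𝔖 hwin hρ1 hI0 hIβ hnβ hm hL0 hc₅0 hε0 hε2
      -- (8.6): `r ≤ 24 (n, r) ≤ 24 P^{1/2}`
      have hr24 : (r : ℝ) ≤ 24 * P ^ (1 / 2 : ℝ) := by
        set r' : ℕ := ∏ p ∈ r.primeFactors.filter (3 < ·), p with hr'
        have hr'n : r' ∣ n := Finset.prod_primes_dvd n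
          (fun p hp => (Nat.prime_of_mem_primeFactors (Finset.mem_filter.mp hp).1).prime)
          (fun p hp => hne p (Finset.mem_filter.mp hp).1 (Finset.mem_filter.mp hp).2)
        have hr'r : r' ∣ r := (Finset.prod_dvd_prod_of_subset _ _ _ (Finset.filter_subset _ _)).trans
          (Nat.prod_primeFactors_dvd r)
        have hr'g : r' ∣ Nat.gcd n r := Nat.dvd_gcd hr'n hr'r
        have hg0 : 0 < Nat.gcd n r := Nat.gcd_pos_of_pos_right n (Nat.pos_of_ne_zero hr)
        have h1 : (r' : ℝ) ≤ Nat.gcd n r := by exact_mod_cast Nat.le_of_dvd hg0 hr'g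
        have h2 : (r : ℝ) ≤ 24 * r' := by
          have hpos : 0 < 24 * r' := Nat.mul_pos (by norm_num) (Finset.prod_pos fun p hp =>
            (Nat.prime_of_mem_primeFactors (Finset.mem_filter.mp hp).1).pos)
          exact_mod_cast Nat.le_of_dvd hpos (dvd_mul_prod_primeFactors_of_isPrimitive hprim hquad)
        linarith
      -- Siegel: `L ≥ C_S r^{-1/8} log P ≥ C_S (24 P^{1/2})^{-1/8} log P`
      have hLlow : C_S * ((24 : ℝ) ^ (-(1 / 8 : ℝ)) * P ^ (-(1 / 16 : ℝ))) * Real.log P ≤ L := by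
        have h1 : (24 * P ^ (1 / 2 : ℝ)) ^ (-(1 / 8 : ℝ)) ≤ (r : ℝ) ^ (-(1 / 8 : ℝ)) :=
          Real.rpow_le_rpow_of_nonpos hr0 hr24 (by norm_num)
        rw [rpow_mul_sqrt_eq hP0] at h1
        calc C_S * ((24 : ℝ) ^ (-(1 / 8 : ℝ)) * P ^ (-(1 / 16 : ℝ))) * Real.log P
            ≤ C_S * (r : ℝ) ^ (-(1 / 8 : ℝ)) * Real.log P := by gcongr
          _ ≤ (1 - β) * Real.log P := mul_le_mul_of_nonneg_right hSieg hlogP0.le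
      -- conclude: `R.re ≥ (c₅ C₂/4) X L − C E₂ ≥ κ₀ X P^{-1/16} log P − C X P^{-1/3} > X P^{-1/3}`
      have hE₂'' : C * (X ^ (1 + δ) * P⁻¹ * (Nat.gcd n r : ℝ)) ≤ C * (X * P ^ (-(1 / 3 : ℝ))) :=
        mul_le_mul_of_nonneg_left (error_two_le hX0 hgcd) hC.le
      have hmainlow : (c₅ * C₂ / 4 * (C_S * (24 : ℝ) ^ (-(1 / 8 : ℝ)))) * P ^ (-(1 / 16 : ℝ)) * Real.log P * X
          ≤ c₅ * C₂ / 4 * X * L := by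
        have := mul_le_mul_of_nonneg_left hLlow (by positivity : 0 ≤ c₅ * C₂ / 4 * X)
        calc _ = c₅ * C₂ / 4 * X * (C_S * ((24 : ℝ) ^ (-(1 / 8 : ℝ)) * P ^ (-(1 / 16 : ℝ))) * Real.log P) := by ring
          _ ≤ _ := this
      have hT6X := mul_lt_mul_of_pos_right hT6 hX0
      have hfin := key.trans hre
      -- `X P^{-1/3} < κ₀ P^{-1/16} log P · X − C X P^{-1/3} ≤ c₅C₂/4 X L − C E₂ ≤ R.re`
      have h1 : X * P ^ (-(1 / 3 : ℝ)) + C * (X * P ^ (-(1 / 3 : ℝ))) <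
          (min (1 / 2) (1 / (4 * c₁)) * C₂ / 4 * (C_S * (24 : ℝ) ^ (-(1 / 8 : ℝ)))) *
            P ^ (-(1 / 16 : ℝ)) * Real.log P * X := by
        have : (C + 1) * P ^ (-(1 / 3 : ℝ)) * X = X * P ^ (-(1 / 3 : ℝ)) + C * (X * P ^ (-(1 / 3 : ℝ))) := by ring
        rw [← this]; exact hT6X
      linarith [h1, hmainlow, hE₂'', hfin]


/-! ### The assembly -/

open Literature.NumberTheory.LFunctions.Siegel in
/-- **§8 of Montgomery–Vaughan 1975: (6.17), (6.1͂7) with (7.1), (7.͂1) imply (8.3).**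
`majorArc_formulae → majorArc_lowerBound`: with `P = X^{6δ}`, for `δ` small and `X ≥ X₀(δ)`,
`Re R₁(n) > X P^{-1/3}` for all even `n ∈ (X/2, X]` except at most `C X P^{-1/3}` of them
(pp. 367–368). No exceptional character: `R₁(n) ≫ X` for all even `n` (from (6.17), (7.1),
`𝔖(n) ≫ n/φ(n)`). Exceptional character `(r̃, χ̃, β̃)` (quadratic by Lemma 4.1, `1 − β̃ ≥ C_S r̃^{-1/8}`
by Siegel's theorem, the tree's `exists_one_sub_realZero_ge`, in place of the effective (4.1)): the
`n` with `(n, r̃) > P^{1/2}` are discarded (at most `d(r̃) X P^{-1/2} ≤ C_τ X P^{-1/3}` of them, divisor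
bound), and every other even `n` has `R₁(n) > XP^{-1/3}` (`exc_case_lowerBound`).
[cite: MontgomeryVaughanActa1975, §8 (8.3)] -/
theorem majorArc_lowerBound_of_formulae (h : majorArc_formulae) : majorArc_lowerBound := by
  obtain ⟨c₁, hc₁, c₆, hc₆, C, hC, δ₀, hδ₀, H⟩ := h
  -- absolute constants
  have hC₂ : 0 < twinPrimeConst := lt_of_lt_of_le (by norm_num) half_le_twinPrimeConst
  obtain ⟨C_S, hCS, hSiegel⟩ := exists_one_sub_realZero_ge (ε := 1 / 8) (by norm_num)
  obtain ⟨C_τ, hCτ, hτ⟩ := exists_card_divisors_le_mul_rpow (ε := 1 / 6) (by norm_num)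
  set c₅ : ℝ := min (1 / 2) (1 / (4 * c₁)) with hc₅
  have hc₅0 : 0 < c₅ := lt_min (by norm_num) (by positivity)
  set θ₀ : ℝ := min (1 / 8) (twinPrimeConst / (16 * C)) with hθ₀
  have hθ₀0 : 0 < θ₀ := lt_min (by norm_num) (by positivity)
  set κ₀ : ℝ := c₅ * twinPrimeConst / 4 * (C_S * (24 : ℝ) ^ (-(1 / 8 : ℝ))) with hκ₀
  have hκ₀0 : 0 < κ₀ := by positivity
  set ε₀ : ℝ := min (twinPrimeConst / (16 * C * c₁))
    (min (c₅ * twinPrimeConst / (4 * C)) (twinPrimeConst / (16 * C))) with hε₀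
  have hε₀0 : 0 < ε₀ := lt_min (by positivity) (lt_min (by positivity) (by positivity))
  set δ₁ : ℝ := c₆ / max 1 (Real.log ε₀⁻¹) with hδ₁
  have hδ₁0 : 0 < δ₁ := div_pos hc₆ (lt_of_lt_of_le zero_lt_one (le_max_left _ _))
  set δs : ℝ := min δ₀ (min δ₁ (1 / 12)) with hδs
  have hδs0 : 0 < δs := lt_min hδ₀ (lt_min hδ₁0 (by norm_num))
  refine ⟨δs, hδs0, C_τ, fun δ hδ hδle => ?_⟩
  have hδδ₀ : δ ≤ δ₀ := hδle.trans (min_le_left _ _)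
  have hδδ₁ : δ ≤ δ₁ := hδle.trans ((min_le_right _ _).trans (min_le_left _ _))
  have hδ12 : δ ≤ 1 / 12 := hδle.trans ((min_le_right _ _).trans (min_le_right _ _))
  -- `ε = e^{-c₆/δ} ≤ ε₀`
  set ε : ℝ := Real.exp (-(c₆ / δ)) with hεdef
  have hε0 : 0 ≤ ε := (Real.exp_pos _).le
  have hεε₀ : ε ≤ ε₀ := by
    have h1 : Real.log ε₀⁻¹ ≤ c₆ / δ := by
      have : max 1 (Real.log ε₀⁻¹) ≤ c₆ / δ := by
        rw [le_div_iff₀ hδ]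
        calc max 1 (Real.log ε₀⁻¹) * δ ≤ max 1 (Real.log ε₀⁻¹) * δ₁ :=
              mul_le_mul_of_nonneg_left hδδ₁ (le_trans zero_le_one (le_max_left _ _))
          _ = c₆ := by rw [hδ₁]; field_simp
      exact (le_max_right _ _).trans this
    calc ε = Real.exp (-(c₆ / δ)) := rfl
      _ ≤ Real.exp (-Real.log ε₀⁻¹) := Real.exp_le_exp.mpr (by linarith)
      _ = ε₀ := by rw [Real.log_inv, neg_neg, Real.exp_log hε₀0]
  have hε1 : C * (c₁ * ε) ≤ twinPrimeConst / 16 := by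
    calc C * (c₁ * ε) ≤ C * (c₁ * ε₀) := by gcongr
      _ ≤ C * (c₁ * (twinPrimeConst / (16 * C * c₁))) := by gcongr; exact min_le_left _ _
      _ = twinPrimeConst / 16 := by field_simp
  have hε2 : C * ε ≤ c₅ * twinPrimeConst / 4 := by
    calc C * ε ≤ C * ε₀ := by gcongr
      _ ≤ C * (c₅ * twinPrimeConst / (4 * C)) := by
          gcongr; exact (min_le_right _ _).trans (min_le_left _ _)
      _ = c₅ * twinPrimeConst / 4 := by field_simp
  have hε3 : C * ε ≤ twinPrimeConst / 16 := by
    calc C * ε ≤ C * ε₀ := by gcongr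
      _ ≤ C * (twinPrimeConst / (16 * C)) := by
          gcongr; exact (min_le_right _ _).trans (min_le_right _ _)
      _ = twinPrimeConst / 16 := by field_simp
  -- the formulae at `δ`, and the thresholds
  obtain ⟨X₀, hX₀⟩ := H δ hδ hδδ₀
  obtain ⟨X₁, hX₁⟩ := Filter.eventually_atTop.mp
    (eventually_thresholds (c₁ := c₁) hδ hδ12 hC hC₂ hCS hθ₀0 hκ₀0)
  refine ⟨max X₀ X₁, fun X hX => ?_⟩
  obtain ⟨hX4, hP2, hPX, hlogP, hT1, hT2, hT3, hT4, hT6⟩ := hX₁ X ((le_max_right _ _).trans hX)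
  obtain ⟨h41, hA, hB⟩ := hX₀ X ((le_max_left _ _).trans hX)
  have hX0 : 0 < X := by linarith
  set P : ℝ := X ^ (6 * δ) with hPdef
  have hP0 : 0 < P := by rw [hPdef]; exact Real.rpow_pos_of_pos hX0 _
  have hP1 : 1 ≤ P := by linarith
  have hlogP0 : 0 < Real.log P := lt_trans hc₁ hlogP
  have hθ₀8 : θ₀ ≤ 1 / 8 := min_le_left _ _
  have hθ₀' : C * θ₀ ≤ twinPrimeConst / 16 := by
    calc C * θ₀ ≤ C * (twinPrimeConst / (16 * C)) := by gcongr; exact min_le_right _ _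
      _ = twinPrimeConst / 16 := by field_simp
  -- the set to bound
  set bad : Finset ℕ := (Finset.Icc 1 ⌊X⌋₊).filter fun n : ℕ => X / 2 < n ∧ Even n ∧
    (majorArcIntegral (X ^ (6 * δ)) (X ^ (1 - 6 * δ)) X n).re ≤ X * (X ^ (6 * δ)) ^ (-(1 / 3 : ℝ))
    with hbad
  show (bad.card : ℝ) ≤ C_τ * X * (X ^ (6 * δ)) ^ (-(1 / 3 : ℝ))
  have hnX : ∀ n ∈ bad, (n : ℝ) ≤ X := fun n hn => by
    have h1 := (Finset.mem_Icc.mp (Finset.mem_filter.mp hn).1).2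
    exact (Nat.cast_le.mpr h1).trans (Nat.floor_le hX0.le)
  have h1n : ∀ n ∈ bad, 1 ≤ n := fun n hn => (Finset.mem_Icc.mp (Finset.mem_filter.mp hn).1).1
  have hRHS : 0 ≤ C_τ * X * (X ^ (6 * δ)) ^ (-(1 / 3 : ℝ)) := by
    have : 0 ≤ C_τ := zero_le_one.trans hCτ
    positivity
  by_cases hexc : ∃ (r : ℕ) (_ : NeZero r) (χ : DirichletCharacter ℂ r) (β : ℝ),
      IsExceptionalZero c₁ P r χ β
  · -- the exceptional character occurs
    obtain ⟨r, _, χ, β, hEZ⟩ := hexc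
    have hquad : χ ^ 2 = 1 := h41.1 r χ β hEZ
    obtain ⟨hprim, hne, hrP, hβlo, hβ1, hzero⟩ := hEZ
    have hr : r ≠ 0 := NeZero.ne r
    have hr0 : (0 : ℝ) < r := by exact_mod_cast Nat.pos_of_ne_zero hr
    have hSieg : C_S * (r : ℝ) ^ (-(1 / 8 : ℝ)) ≤ 1 - β := hSiegel r χ hquad hne β hzero
    -- every bad `n` has `(n, r) > P^{1/2}`
    have hsub : bad ⊆ (Finset.Icc 1 ⌊X⌋₊).filter fun n : ℕ => P ^ (1 / 2 : ℝ) < (Nat.gcd n r : ℝ) := by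
      intro n hn
      have hn' := Finset.mem_filter.mp hn
      obtain ⟨hwin, heven, hle⟩ := hn'.2
      refine Finset.mem_filter.mpr ⟨hn'.1, ?_⟩
      by_contra hgcd
      push Not at hgcd
      have hBn := hB r χ β ⟨hprim, hne, hrP, hβlo, hβ1, hzero⟩ n (h1n n hn) (hnX n hn) heven
      have hlow := exc_case_lowerBound hprim hquad hC hc₁ hCS hε0 hX4 hP2 hPX hlogP hT1 hT2 hT3 hT4
        hθ₀8 hθ₀' hT6 hε1 hε2 hβlo hβ1 hSieg heven hwin (hnX n hn) hgcd hBn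
      linarith
    -- and there are few such `n`: `≤ d(r) X P^{-1/2} ≤ C_τ r^{1/6} X P^{-1/2} ≤ C_τ X P^{-1/3}`
    have hsqrt : 0 < P ^ (1 / 2 : ℝ) := Real.rpow_pos_of_pos hP0 _
    calc (bad.card : ℝ) ≤ _ := by exact_mod_cast Finset.card_le_card hsub
      _ ≤ (r.divisors.card : ℝ) * (⌊X⌋₊ / P ^ (1 / 2 : ℝ)) := card_filter_gcd_gt_le hr ⌊X⌋₊ hsqrt
      _ ≤ (C_τ * (r : ℝ) ^ (1 / 6 : ℝ)) * (X / P ^ (1 / 2 : ℝ)) := by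
          apply mul_le_mul (hτ r hr) _ (by positivity) (by positivity)
          exact div_le_div_of_nonneg_right (Nat.floor_le hX0.le) hsqrt.le
      _ ≤ (C_τ * P ^ (1 / 6 : ℝ)) * (X / P ^ (1 / 2 : ℝ)) := by
          have : (r : ℝ) ^ (1 / 6 : ℝ) ≤ P ^ (1 / 6 : ℝ) := Real.rpow_le_rpow hr0.le hrP (by norm_num)
          have h0 : 0 ≤ C_τ := zero_le_one.trans hCτ
          gcongr
      _ = C_τ * X * (X ^ (6 * δ)) ^ (-(1 / 3 : ℝ)) := by
          rw [← hPdef]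
          have : P ^ (1 / 6 : ℝ) / P ^ (1 / 2 : ℝ) = P ^ (-(1 / 3 : ℝ)) := by
            rw [← Real.rpow_sub hP0]; norm_num
          calc C_τ * P ^ (1 / 6 : ℝ) * (X / P ^ (1 / 2 : ℝ)) = C_τ * X * (P ^ (1 / 6 : ℝ) / P ^ (1 / 2 : ℝ)) := by
                ring
            _ = C_τ * X * P ^ (-(1 / 3 : ℝ)) := by rw [this]
  · -- no exceptional character: no exceptions at all
    have hAn := hA (fun r inst χ β hz => hexc ⟨r, inst, χ, β, hz⟩)
    have hcard : bad = ∅ := by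
      refine Finset.eq_empty_of_forall_notMem fun n hn => ?_
      have hn' := Finset.mem_filter.mp hn
      obtain ⟨hwin, heven, hle⟩ := hn'.2
      have hn0 : n ≠ 0 := by have := h1n n hn; omega
      have hBn := hAn n (h1n n hn) (hnX n hn)
      have hre := re_ge_of_norm_sub_le hBn
      -- `t = n/φ(n) ≥ 1`, `𝔖(n) ≥ C₂ t`
      have hφn : (0 : ℝ) < Nat.totient n := by exact_mod_cast Nat.totient_pos.mpr (Nat.pos_of_ne_zero hn0)
      have ht : 1 ≤ (n : ℝ) / (Nat.totient n : ℝ) := by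
        rw [le_div_iff₀ hφn, one_mul]; exact_mod_cast Nat.totient_le n
      have h𝔖 := twinPrimeConst_mul_div_totient_le heven hn0
      have hεb : C * ε ≤ twinPrimeConst / 8 := by linarith [hC₂, hε3]
      have hE : C * (X ^ (1 + δ) * (X ^ (6 * δ))⁻¹) ≤ twinPrimeConst * X / 8 := by
        have hC₂X : 0 ≤ twinPrimeConst * X := by positivity
        rw [← mul_assoc]; linarith
      have key := case_noExc hC₂ hX0 ht h𝔖 hwin hεb hE
      have hfin := key.trans hre
      have hC₂X : 0 ≤ twinPrimeConst * X := by positivity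
      linarith
    rw [hcard, Finset.card_empty, Nat.cast_zero]
    exact hRHS


end Literature.NumberTheory.Sieve.MontgomeryVaughan1975

namespace Literature.NumberTheory.Sieve

open MontgomeryVaughan1975

/-- **Montgomery–Vaughan 1975, Theorem 1, from the major-arc formulae** (parity.S15,
`E(x) ≪ x^{1-δ}`): `majorArc_formulae → goldbachExceptionalCount_isBigO_rpow`, by §8
(`majorArc_lowerBound_of_formulae`) and the tree's unconditional assembly above (8.3)
(`goldbachExceptionalCount_isBigO_rpow_of_majorArc_mv`: the minor arcs (3.2), Vinogradov's
Lemma 3.1, the counting (8.1)–(8.2) and the dyadic summation are proved). After this the named fact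
`Literature.NumberTheory.Sieve.goldbachExceptionalCount_isBigO_rpow` rests on
`Literature.NumberTheory.Sieve.MontgomeryVaughan1975.majorArc_formulae` — (6.17), (6.1͂7) with (7.1),
(7.͂1): Gallagher's Lemmas 4.2–4.3 and §§5–7 of the paper — alone.
[cite: MontgomeryVaughanActa1975, Theorem 1] -/
theorem goldbachExceptionalCount_isBigO_rpow_of_formulae (h : majorArc_formulae) :
    goldbachExceptionalCount_isBigO_rpow :=
  goldbachExceptionalCount_isBigO_rpow_of_majorArc_mv (majorArc_lowerBound_of_formulae h)

end Literature.NumberTheory.Sieve
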